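import Summits.HodgeConjecture.CorCM.MumfordTateRankRibetTypeOnePairsRigidDistinctFields
import Literature.AlgebraicGeometry.Motives.HodgeLieRigidOfCenterRankLeOne
import HarnessLib

/-!
# Two NON-ISOGENOUS Ribet-type abelian varieties with ISOMORPHIC fields: `H¹(A × A′)` is `Θ`-rigid for ALL `g, g′ ≥ 3` (the centre of
# `Lie Hg` is a line, and `tr((ι₁φ₁^*π₁)_ℂ Θ) = ±2(g − 2) i√d ≠ 0`); hence EVERY non-isogenous Ribet pair is a monotone factor

COR-CM (cell `pub-hodgecm2`, seat `b27` gen 54, count-neutral Mumford–Tate-rank ladder; theorems only, no definition, no named fact; UNCONDITIONAL —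
nothing here uses or asserts HC_CM).  Completes gen 53ʼs `CorCM/MumfordTateRankRibetTypeOnePairsRigid` (`g ≠ g′`) and gen 54ʼs
`…RigidDistinctFields` (non-isomorphic fields): for `A`, `A′` of Ribet types `(g−1,1)`, `(g′−1,1)`, `A ≁ A′`, `End⁰A ≅ End⁰A′`, the Hodge Lie algebra
`𝔥 = Lie Hg(H¹(A × A′))` has dimension `g² + g′² − 1` (gen 53, Weil classes), its derived algebra contains both corners `ι_i𝔡_iπ_i` (dimension
`≥ g² + g′² − 2`), so its centre `𝔷 ⊆ ℚι₁φ₁^*π₁ ⊕ ℚι₂φ₂^*π₂` is a LINE (were it the plane, `dim 𝔥 ≥ g² + g′²`,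
`UnitaryPair.finrank_add_finrank_add_two_le_of_corners`); and the Hodge endomorphism `c = ι₁φ₁^*π₁` has `tr(c_ℂ Θ) = tr(Θ_A φ₁^*) = ±2(g−2)i√d ≠ 0`.
By `Motives/HodgeLieRigidOfCenterRankLeOne` (centre of rank `≤ 1` + one Hodge endomorphism not trace-orthogonal to `Θ` ⟹ rigid):
* **`hodgeLie_rigid_prod_ribetTypeOne_of_nonempty_ringHom`** — `H¹(A × A′)` is `Θ`-rigid (isomorphic fields, `A ≁ A′`, any `g, g′ ≥ 3`);
* **`hodgeLie_rigid_prod_ribetTypeOne`** — `H¹(A × A′)` is `Θ`-rigid for EVERY non-isogenous Ribet pair;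
* **`mtRank_hodge_one_le_of_isIsogenous_prod_ribetTypeOne_prod'`** — `t(X) ≥ t(A × A′)` for `X ∼ (A × A′) × Y`, every non-isogenous Ribet pair.

## References
* [MoonenZarhin1999LowDim] B. Moonen, Yu. G. Zarhin, *Hodge classes on abelian varieties of low dimension*, Math. Ann. 315 (1999), §3 (3.1), Lemma (3.4)
  [corpus: paper:arxiv-math_9901113 p. 6]. [cite: MoonenZarhin1999LowDim, §3 (3.1) and Lemma (3.4)]
* [Deligne1982HodgeCycles] P. Deligne, LNM 900 (1982), I §3 Prop. 3.6. [cite: Deligne1982HodgeCycles, I §3 Prop. 3.6]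
* [DeligneMilne1982Tannakian] P. Deligne, J. Milne, LNM 900 (1982), §6 Thm. 6.20 (Riemann). [cite: DeligneMilne1982Tannakian, §6 Thm. 6.20]
* [Ribet1983] K. A. Ribet, Amer. J. Math. 105 (1983), Thm. 3. [cite: Ribet1983, Thm. 3]
* [Gordon1997] B. B. Gordon, *A survey of the Hodge conjecture for abelian varieties*, 1.13.2. [cite: Gordon1997, 1.13.2]
-/

noncomputable section

open scoped TensorProduct
open CategoryTheory CategoryTheory.Limits Module NumberField

namespace Summit.HodgeConjecture.CorCM

open Literature.AlgebraicGeometry.Motives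
open Literature.AlgebraicGeometry.Motives.AbelianVariety
open Literature.AlgebraicGeometry.Motives.HodgeStructure
open Literature.AlgebraicGeometry.HodgeTheory
open Literature.AlgebraicGeometry.ComplexMultiplication
open Literature.AlgebraicGeometry.Milne1999 (hom_eq_zero_of_isSimple_of_not_isIsogenous)

variable [HodgeTensorFacts.{0, 0}] {X : AbelianVariety ℂ} {n : ℕ}

set_option maxHeartbeats 1600000 in
/-- **`H¹(A × A′)` is `Θ`-rigid for non-isogenous `A`, `A′` of Ribet types `(g−1,1)`, `(g′−1,1)` (`g, g′ ≥ 3`) with ISOMORPHIC fields** (a ring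
homomorphism `End⁰A′ → End⁰A`): the centre of `Lie Hg(H¹(A × A′))` is a line and `tr((ι₁φ₁^*π₁)_ℂ Θ) ≠ 0` (module docstring).
[cite: MoonenZarhin1999LowDim, §3 (3.1) and Lemma (3.4)] [cite: Deligne1982HodgeCycles, I §3 Prop. 3.6] [cite: Gordon1997, 1.13.2]
[cite: DeligneMilne1982Tannakian, §6 Thm. 6.20] -/
theorem hodgeLie_rigid_prod_ribetTypeOne_of_nonempty_ringHom {A A' : AbelianVariety ℂ} {m : ℕ} (hP : IsSmoothProjective m (A.prod A').X)
    (hF : IsField A.endAlgebra) (hnR : ¬ IsTotallyReal (EndField A hF)) (φ : A ⟶ A) {d : ℕ} (hd : 0 < d) (hφ : φ ≫ φ = -(d • 𝟙 A))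
    (hAE : Module.finrank ℚ A.endAlgebra = 2)
    (h1 : eigenMultiplicity A φ (Complex.I * (Real.sqrt d : ℂ)) = 1 ∨ eigenMultiplicity A φ (-(Complex.I * (Real.sqrt d : ℂ))) = 1) (hdim : 3 ≤ A.dim)
    (hF' : IsField A'.endAlgebra) (hnR' : ¬ IsTotallyReal (EndField A' hF')) (φ' : A' ⟶ A') {d' : ℕ} (hd' : 0 < d') (hφ' : φ' ≫ φ' = -(d' • 𝟙 A'))
    (hA'E : Module.finrank ℚ A'.endAlgebra = 2)
    (h1' : eigenMultiplicity A' φ' (Complex.I * (Real.sqrt d' : ℂ)) = 1 ∨ eigenMultiplicity A' φ' (-(Complex.I * (Real.sqrt d' : ℂ))) = 1)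
    (hdim' : 3 ≤ A'.dim) (hfor : Nonempty (A'.endAlgebra →+* A.endAlgebra)) (hni : ¬ IsIsogenous A A') :
    haveI := BettiUniverse.finite hP 1
    ∀ 𝔞 : Submodule ℚ (Module.End ℚ (bettiCohomology (A.prod A').X 1)),
      𝔞 ≤ (BettiUniverse.hodge exists_isReal_hodgeModel_holds hP 1).hodgeLie →
      (∀ B ∈ 𝔞, ∀ B' ∈ 𝔞, B * B' - B' * B ∈ 𝔞) →
      (∃ Θ ∈ Submodule.span ℂ ((fun B : Module.End ℚ (bettiCohomology (A.prod A').X 1) => B.baseChange ℂ) ''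
          (𝔞 : Set (Module.End ℚ (bettiCohomology (A.prod A').X 1)))),
        ∀ p, ∀ x ∈ (BettiUniverse.hodge exists_isReal_hodgeModel_holds hP 1).piece p (((1 : ℕ) : ℤ) - p),
          Θ x = ((2 * p - ((1 : ℕ) : ℤ) : ℤ) : ℂ) • x) →
      (BettiUniverse.hodge exists_isReal_hodgeModel_holds hP 1).hodgeLie ≤ 𝔞 := by
  classical
  have hnP : (A.prod A').dim = m := schemeDim_eq_holds hP
  subst hnP
  have hT : IsSmoothProjective A.dim A.X := AbelianVariety.isSmoothProjective_holds
  have hT' : IsSmoothProjective A'.dim A'.X := AbelianVariety.isSmoothProjective_holds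
  haveI := BettiUniverse.finite hP 1
  haveI := BettiUniverse.finite hT 1
  haveI := BettiUniverse.finite hT' 1
  haveI : Nontrivial (bettiCohomology A.X 1) := Module.nontrivial_of_finrank_pos (R := ℚ) (by rw [finrank_bettiCohomology_one A]; omega)
  haveI : Nontrivial (bettiCohomology A'.X 1) := Module.nontrivial_of_finrank_pos (R := ℚ) (by rw [finrank_bettiCohomology_one A']; omega)
  have hAs : A.IsSimple := isSimple_of_isField_endAlgebra hF
  have hA's : A'.IsSimple := isSimple_of_isField_endAlgebra hF'
  -- per-factor data
  obtain ⟨μ₁, k₁, hφ₁E, hφ₁2, hE₁, hμ₁, h1₁, h2₁, hφ₁𝔥, hZ₁, hσ₁, hk₁, hτ₁⟩ := ribetTypeOne_factor_data hT φ hd hφ hAE h1 hdim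
  obtain ⟨μ₂, k₂, hφ₂E, hφ₂2, hE₂, hμ₂, h1₂, h2₂, -, hZ₂, hσ₂, hk₂, hτ₂⟩ := ribetTypeOne_factor_data hT' φ' hd' hφ' hA'E h1' hdim'
  obtain ⟨hsimple₁, hcent₁, h8₁⟩ := derived_facts_of_ribetTypeOne hT hF hnR φ hd hφ hAE h1 hdim
  obtain ⟨hsimple₂, hcent₂, h8₂⟩ := derived_facts_of_ribetTypeOne hT' hF' hnR' φ' hd' hφ' hA'E h1' hdim'
  set φ₁ : Module.End ℚ (bettiCohomology A.X 1) := (bettiCohomology.map φ.hom.hom.hom 1).hom with hφ₁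
  set φ₂ : Module.End ℚ (bettiCohomology A'.X 1) := (bettiCohomology.map φ'.hom.hom.hom 1).hom with hφ₂
  set H := BettiUniverse.hodge exists_isReal_hodgeModel_holds hP 1 with hHdef
  set H₁ := BettiUniverse.hodge exists_isReal_hodgeModel_holds hT 1 with hH₁def
  set H₂ := BettiUniverse.hodge exists_isReal_hodgeModel_holds hT' 1 with hH₂def
  obtain ⟨ψ₁⟩ := BettiUniverse.hodge_isPolarizable exists_isReal_hodgeModel_holds hT 1
  obtain ⟨ψ₂⟩ := BettiUniverse.hodge_isPolarizable exists_isReal_hodgeModel_holds hT' 1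
  obtain ⟨ψ⟩ := BettiUniverse.hodge_isPolarizable exists_isReal_hodgeModel_holds hP 1
  have heff₁ := BettiUniverse.hodge_isEffective exists_isReal_hodgeModel_holds hT 1
  have heff₂ := BettiUniverse.hodge_isEffective exists_isReal_hodgeModel_holds hT' 1
  have hd₁Q : (0 : ℚ) < d := Nat.cast_pos.2 hd
  have hd₂Q : (0 : ℚ) < d' := Nat.cast_pos.2 hd'
  -- the bicone of `H¹(A × A')`
  let ι₁ := BettiUniverse.pullHodgeHom exists_isReal_hodgeModel_holds hodgePQ_independent_of_hodgeModel_holds hP hT (fst A A').hom.hom.hom 1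
  let π₁ := BettiUniverse.pullHodgeHom exists_isReal_hodgeModel_holds hodgePQ_independent_of_hodgeModel_holds hT hP
    (prodLift (𝟙 A) (0 : A ⟶ A')).hom.hom.hom 1
  let ι₂ := BettiUniverse.pullHodgeHom exists_isReal_hodgeModel_holds hodgePQ_independent_of_hodgeModel_holds hP hT' (snd A A').hom.hom.hom 1
  let π₂ := BettiUniverse.pullHodgeHom exists_isReal_hodgeModel_holds hodgePQ_independent_of_hodgeModel_holds hT' hP
    (prodLift (0 : A' ⟶ A) (𝟙 A')).hom.hom.hom 1
  have hsumP : fst A A' ≫ prodLift (𝟙 A) (0 : A ⟶ A') + snd A A' ≫ prodLift (0 : A' ⟶ A) (𝟙 A') = 𝟙 _ := by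
    refine prod_hom_ext ?_ ?_
    · rw [Preadditive.add_comp, Category.assoc, Category.assoc, prodLift_fst, prodLift_fst, Category.comp_id, comp_zero, add_zero, Category.id_comp]
    · rw [Preadditive.add_comp, Category.assoc, Category.assoc, prodLift_snd, prodLift_snd, Category.comp_id, comp_zero, zero_add, Category.id_comp]
  have hπι₁ : ∀ v, π₁.toLinearMap (ι₁.toLinearMap v) = v := fun v => pull_pull_eq_self_of_comp_eq_id (prodLift_fst _ _) v
  have hπι₂ : ∀ v, π₂.toLinearMap (ι₂.toLinearMap v) = v := fun v => pull_pull_eq_self_of_comp_eq_id (prodLift_snd _ _) v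
  have hsum : ∀ v, ι₁.toLinearMap (π₁.toLinearMap v) + ι₂.toLinearMap (π₂.toLinearMap v) = v := fun v =>
    pull_pull_add_pull_pull_eq_self _ _ _ _ hsumP v
  -- the skew centre of `Lie Hg(H¹(A × A'))` is on `ℚ ι₁φ₁π₁ + ℚ ι₂φ₂π₂`
  have hZ : ∀ z ∈ H.hodgeLie ⊓ Subalgebra.toSubmodule H.endAlg, ∃ x₁ x₂ : ℚ,
      z = x₁ • (ι₁.toLinearMap ∘ₗ φ₁ ∘ₗ π₁.toLinearMap) + x₂ • (ι₂.toLinearMap ∘ₗ φ₂ ∘ₗ π₂.toLinearMap) := by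
    intro z hz
    obtain ⟨hz𝔥, hzE⟩ := Submodule.mem_inf.1 hz
    rw [Subalgebra.mem_toSubmodule] at hzE
    have hb := eq_sum_blocks_of_mem_hodgeLie ι₁ π₁ ι₂ π₂ hπι₁ hπι₂ hsum hz𝔥
    obtain ⟨x₁, hx₁⟩ := hZ₁ ψ₁ _ (Submodule.mem_inf.2 ⟨comp_mem_hodgeLie_of_retract ι₁ π₁ hπι₁ hz𝔥,
      ((π₁.comp (endAlg.toHom ⟨z, hzE⟩)).comp ι₁).toLinearMap_mem_endAlg⟩)
    obtain ⟨x₂, hx₂⟩ := hZ₂ ψ₂ _ (Submodule.mem_inf.2 ⟨comp_mem_hodgeLie_of_retract ι₂ π₂ hπι₂ hz𝔥,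
      ((π₂.comp (endAlg.toHom ⟨z, hzE⟩)).comp ι₂).toLinearMap_mem_endAlg⟩)
    refine ⟨x₁, x₂, ?_⟩
    rw [hb, hx₁, hx₂]
    simp only [LinearMap.smul_comp, LinearMap.comp_smul]
  -- no non-zero Hodge morphism `H¹A → H¹A'`
  have hAA : ∀ u : A' ⟶ A, u = 0 := hom_eq_zero_of_isSimple_of_not_isIsogenous hA's hAs (fun h => hni h.symm')
  have hnohom : ∀ f : bettiCohomology A.X 1 →ₗ[ℚ] bettiCohomology A'.X 1,
      (∀ r : ℤ, ∀ x ∈ (BettiUniverse.hodge exists_isReal_hodgeModel_holds hT 1).piece r (((1 : ℕ) : ℤ) - r),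
        f.baseChange ℂ x ∈ (BettiUniverse.hodge exists_isReal_hodgeModel_holds hT' 1).piece r (((1 : ℕ) : ℤ) - r)) → f = 0 := by
    intro f hf
    refine forall_isHodgeMorphismOne_eq_zero_of_forall_hom_eq_zero hAA f ⟨fun x hx => ?_, fun x hx => ?_⟩
    · have hx' := (BettiUniverse.mem_hodge_piece_iff exists_isReal_hodgeModel_holds hodgePQ_independent_of_hodgeModel_holds hT (k := 1)
        (p := 1) (q := 0) rfl _).2 hx
      have e : (((1 : ℕ) : ℤ) - 1) = 0 := by norm_num
      have h := hf 1 x (by rw [e]; exact hx')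
      rw [e] at h
      exact (BettiUniverse.mem_hodge_piece_iff exists_isReal_hodgeModel_holds hodgePQ_independent_of_hodgeModel_holds hT' (k := 1)
        (p := 1) (q := 0) rfl _).1 h
    · have hx' := (BettiUniverse.mem_hodge_piece_iff exists_isReal_hodgeModel_holds hodgePQ_independent_of_hodgeModel_holds hT (k := 1)
        (p := 0) (q := 1) rfl _).2 hx
      have e : (((1 : ℕ) : ℤ) - 0) = 1 := by norm_num
      have h := hf 0 x (by rw [e]; exact hx')
      rw [e] at h
      exact (BettiUniverse.mem_hodge_piece_iff exists_isReal_hodgeModel_holds hodgePQ_independent_of_hodgeModel_holds hT' (k := 1)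
        (p := 0) (q := 1) rfl _).1 h
  have h9₁ : 3 * 3 ≤ A.dim * A.dim := Nat.mul_le_mul hdim hdim
  have h9₂ : 3 * 3 ≤ A'.dim * A'.dim := Nat.mul_le_mul hdim' hdim'
  have h𝔡₁0 : Submodule.span ℚ {B | ∃ X' ∈ (BettiUniverse.hodge exists_isReal_hodgeModel_holds hT 1).hodgeLie,
      ∃ Y ∈ (BettiUniverse.hodge exists_isReal_hodgeModel_holds hT 1).hodgeLie, X' * Y - Y * X' = B} ≠ ⊥ := fun h => by
    rw [h, finrank_bot] at h8₁; omega
  have h𝔡₂0 : Submodule.span ℚ {B | ∃ X' ∈ (BettiUniverse.hodge exists_isReal_hodgeModel_holds hT' 1).hodgeLie,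
      ∃ Y ∈ (BettiUniverse.hodge exists_isReal_hodgeModel_holds hT' 1).hodgeLie, X' * Y - Y * X' = B} ≠ ⊥ := fun h => by
    rw [h, finrank_bot] at h8₂; omega
  obtain ⟨hc₁, hc₂, -⟩ := UnitaryPair.corners_le_and_finrank_le ι₁ π₁ ι₂ π₂ hπι₁ hπι₂ hsum Nat.cast_one heff₁ heff₂ ψ₁ ψ₂ ψ hφ₁E hd₁Q hφ₁2
    hE₁ hμ₁ h1₁ h2₁ hφ₂E hd₂Q hφ₂2 hE₂ hμ₂ h1₂ h2₂ (hodgeLie_rigid_of_ribetTypeOne hT φ hd hφ hAE h1 hdim)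
    (hodgeLie_rigid_of_ribetTypeOne hT' φ' hd' hφ' hA'E h1' hdim') hZ hφ₁𝔥 (hZ₁ ψ₁) (hZ₂ ψ₂) hsimple₁ hsimple₂ hcent₁ hcent₂ h𝔡₁0 h𝔡₂0 hnohom
  -- `dim 𝔥 = g² + g′² − 1` (isomorphic fields, `A ≁ A′`)
  have h0 : 0 < (A.prod A').dim := by rw [dim_prod]; omega
  have ht := mtRank_hodge_one_eq_of_isIsogenous_prod_ribetTypeOne_of_nonempty_ringHom' hP hF hnR φ hd hφ hAE h1 hdim hF' hnR' φ' hd' hφ' hA'E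
    h1' hdim' hfor hni (IsIsogenous.refl _)
  rw [mtRank_hodge_one_eq_finrank_hodgeLie_add_one hP h0] at ht
  have ht' : Module.finrank ℚ H.hodgeLie + 1 = A.dim * A.dim + A'.dim * A'.dim := ht
  -- the centre is a line: were it the plane `ℚE₁ ⊕ ℚE₂`, `dim 𝔥 ≥ g² + g′²`
  set E₁ : Module.End ℚ (bettiCohomology (A.prod A').X 1) := ι₁.toLinearMap ∘ₗ φ₁ ∘ₗ π₁.toLinearMap with hE₁def
  set E₂ : Module.End ℚ (bettiCohomology (A.prod A').X 1) := ι₂.toLinearMap ∘ₗ φ₂ ∘ₗ π₂.toLinearMap with hE₂def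
  set P : Submodule ℚ (Module.End ℚ (bettiCohomology (A.prod A').X 1)) :=
    Submodule.span ℚ ((({E₁, E₂} : Finset (Module.End ℚ (bettiCohomology (A.prod A').X 1))) : Set _)) with hPdef
  have hE₁P : E₁ ∈ P := Submodule.subset_span (by rw [Finset.coe_pair]; exact Set.mem_insert _ _)
  have hE₂P : E₂ ∈ P := Submodule.subset_span (by rw [Finset.coe_pair]; exact Set.mem_insert_of_mem _ (Set.mem_singleton _))
  have h𝔷le : H.hodgeLie ⊓ Subalgebra.toSubmodule H.endAlg ≤ P := by
    intro z hz
    obtain ⟨x₁, x₂, rfl⟩ := hZ z hz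
    exact P.add_mem (P.smul_mem _ hE₁P) (P.smul_mem _ hE₂P)
  have hP2 : Module.finrank ℚ ↥P ≤ 2 := (finrank_span_finset_le_card _).trans Finset.card_le_two
  have h𝔷1 : Module.finrank ℚ ↥(H.hodgeLie ⊓ Subalgebra.toSubmodule H.endAlg) ≤ 1 := by
    by_contra hlt
    rw [not_le] at hlt
    have heq : H.hodgeLie ⊓ Subalgebra.toSubmodule H.endAlg = P :=
      Submodule.eq_of_le_of_finrank_le h𝔷le (hP2.trans (by omega))
    have hE₁𝔥 : E₁ ∈ H.hodgeLie := by
      have h := hE₁P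
      rw [← heq] at h; exact (Submodule.mem_inf.1 h).1
    have hE₂𝔥 : E₂ ∈ H.hodgeLie := by
      have h := hE₂P
      rw [← heq] at h; exact (Submodule.mem_inf.1 h).1
    have h := UnitaryPair.finrank_add_finrank_add_two_le_of_corners ι₁ π₁ ι₂ π₂ hπι₁ hπι₂ hsum hφ₁E hφ₂E hd₁Q hφ₁2 hd₂Q hφ₂2 hc₁ hc₂ hE₁𝔥 hE₂𝔥
    rw [h8₁, h8₂] at h
    omega
  -- the Hodge endomorphism `E₁` is not trace-orthogonal to `Θ`
  have hE₁E : E₁ ∈ H.endAlg := ((ι₁.comp (endAlg.toHom ⟨φ₁, hφ₁E⟩)).comp π₁).toLinearMap_mem_endAlg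
  obtain ⟨Θ₀, hΘ₀⟩ := exists_hodgeTheta H
  have hπιC : ∀ y, π₁.toLinearMap.baseChange ℂ (ι₁.toLinearMap.baseChange ℂ y) = y := fun y => by
    have h := congrArg (LinearMap.baseChange ℂ) (LinearMap.ext hπι₁ : π₁.toLinearMap ∘ₗ ι₁.toLinearMap = LinearMap.id)
    rw [LinearMap.baseChange_comp, LinearMap.baseChange_id] at h
    exact LinearMap.congr_fun h y
  have hΘ₁ : ∀ p, ∀ x ∈ H₁.piece p (((1 : ℕ) : ℤ) - p),
      (π₁.toLinearMap.baseChange ℂ ∘ₗ Θ₀ ∘ₗ ι₁.toLinearMap.baseChange ℂ) x = ((2 * p - ((1 : ℕ) : ℤ) : ℤ) : ℂ) • x := by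
    intro p x hx
    have hιx : ι₁.toLinearMap.baseChange ℂ x ∈ H.piece p (((1 : ℕ) : ℤ) - p) := Hom.map_piece_le ι₁ p _ ⟨x, hx, rfl⟩
    rw [LinearMap.comp_apply, LinearMap.comp_apply, hΘ₀ p _ hιx, map_smul, hπιC]
  have htr : LinearMap.trace ℂ _ (E₁.baseChange ℂ * Θ₀) = (Complex.I * (Real.sqrt d : ℂ)) * k₁ := by
    rw [← hτ₁ _ hΘ₁]
    have e1 : E₁.baseChange ℂ * Θ₀ =
        ι₁.toLinearMap.baseChange ℂ ∘ₗ (φ₁.baseChange ℂ ∘ₗ π₁.toLinearMap.baseChange ℂ ∘ₗ Θ₀) := by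
      rw [hE₁def, LinearMap.baseChange_comp, LinearMap.baseChange_comp]; rfl
    have e2 : (φ₁.baseChange ℂ ∘ₗ π₁.toLinearMap.baseChange ℂ ∘ₗ Θ₀) ∘ₗ ι₁.toLinearMap.baseChange ℂ =
        φ₁.baseChange ℂ * (π₁.toLinearMap.baseChange ℂ ∘ₗ Θ₀ ∘ₗ ι₁.toLinearMap.baseChange ℂ) := rfl
    rw [e1, LinearMap.trace_comp_comm', e2, LinearMap.trace_mul_comm]
  have hcΘ : LinearMap.trace ℂ _ (E₁.baseChange ℂ * Θ₀) ≠ 0 := by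
    rw [htr]
    refine mul_ne_zero (mul_ne_zero Complex.I_ne_zero ?_) (by exact_mod_cast hk₁)
    exact_mod_cast (Real.sqrt_pos.2 (by exact_mod_cast hd)).ne'
  exact rigid_of_finrank_center_le_one H ⟨ψ⟩ hΘ₀ h𝔷1 hE₁E hcΘ

/-- **`H¹(A × A′)` is `Θ`-rigid for EVERY pair of non-isogenous Ribet-type abelian varieties** (`(g−1,1)`, `(g′−1,1)`, `g, g′ ≥ 3`): isomorphic fields
above, non-isomorphic fields `…RigidDistinctFields`. [cite: MoonenZarhin1999LowDim, §3 (3.1) and Lemma (3.4)] [cite: Ribet1983, Thm. 3] -/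
theorem hodgeLie_rigid_prod_ribetTypeOne {A A' : AbelianVariety ℂ} {m : ℕ} (hP : IsSmoothProjective m (A.prod A').X)
    (hF : IsField A.endAlgebra) (hnR : ¬ IsTotallyReal (EndField A hF)) (φ : A ⟶ A) {d : ℕ} (hd : 0 < d) (hφ : φ ≫ φ = -(d • 𝟙 A))
    (hAE : Module.finrank ℚ A.endAlgebra = 2)
    (h1 : eigenMultiplicity A φ (Complex.I * (Real.sqrt d : ℂ)) = 1 ∨ eigenMultiplicity A φ (-(Complex.I * (Real.sqrt d : ℂ))) = 1) (hdim : 3 ≤ A.dim)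
    (hF' : IsField A'.endAlgebra) (hnR' : ¬ IsTotallyReal (EndField A' hF')) (φ' : A' ⟶ A') {d' : ℕ} (hd' : 0 < d') (hφ' : φ' ≫ φ' = -(d' • 𝟙 A'))
    (hA'E : Module.finrank ℚ A'.endAlgebra = 2)
    (h1' : eigenMultiplicity A' φ' (Complex.I * (Real.sqrt d' : ℂ)) = 1 ∨ eigenMultiplicity A' φ' (-(Complex.I * (Real.sqrt d' : ℂ))) = 1)
    (hdim' : 3 ≤ A'.dim) (hni : ¬ IsIsogenous A A') :
    haveI := BettiUniverse.finite hP 1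
    ∀ 𝔞 : Submodule ℚ (Module.End ℚ (bettiCohomology (A.prod A').X 1)),
      𝔞 ≤ (BettiUniverse.hodge exists_isReal_hodgeModel_holds hP 1).hodgeLie →
      (∀ B ∈ 𝔞, ∀ B' ∈ 𝔞, B * B' - B' * B ∈ 𝔞) →
      (∃ Θ ∈ Submodule.span ℂ ((fun B : Module.End ℚ (bettiCohomology (A.prod A').X 1) => B.baseChange ℂ) ''
          (𝔞 : Set (Module.End ℚ (bettiCohomology (A.prod A').X 1)))),
        ∀ p, ∀ x ∈ (BettiUniverse.hodge exists_isReal_hodgeModel_holds hP 1).piece p (((1 : ℕ) : ℤ) - p),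
          Θ x = ((2 * p - ((1 : ℕ) : ℤ) : ℤ) : ℂ) • x) →
      (BettiUniverse.hodge exists_isReal_hodgeModel_holds hP 1).hodgeLie ≤ 𝔞 := by
  rcases isEmpty_or_nonempty (A'.endAlgebra →+* A.endAlgebra) with hfor | hfor
  · exact hodgeLie_rigid_prod_ribetTypeOne_of_isEmpty_ringHom hP φ hd hφ hAE h1 hdim φ' hd' hφ' hA'E h1' hdim' hfor
  · exact hodgeLie_rigid_prod_ribetTypeOne_of_nonempty_ringHom hP hF hnR φ hd hφ hAE h1 hdim hF' hnR' φ' hd' hφ' hA'E h1' hdim' hfor hni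

/-- **`t(X) ≥ t(A × A′)` for `X ∼ (A × A′) × Y` and EVERY non-isogenous Ribet pair `A`, `A′`** (any `g, g′ ≥ 3`, any fields): Ribet pairs are monotone
factors of the ladder. [cite: MoonenZarhin1999LowDim, §3 (3.1) and Lemma (3.4)] [cite: Ribet1983, Thm. 3] -/
theorem mtRank_hodge_one_le_of_isIsogenous_prod_ribetTypeOne_prod' (hX : IsSmoothProjective n X.X) {A A' Y : AbelianVariety ℂ} {m : ℕ}
    (hP : IsSmoothProjective m (A.prod A').X)
    (hF : IsField A.endAlgebra) (hnR : ¬ IsTotallyReal (EndField A hF)) (φ : A ⟶ A) {d : ℕ} (hd : 0 < d) (hφ : φ ≫ φ = -(d • 𝟙 A))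
    (hAE : Module.finrank ℚ A.endAlgebra = 2)
    (h1 : eigenMultiplicity A φ (Complex.I * (Real.sqrt d : ℂ)) = 1 ∨ eigenMultiplicity A φ (-(Complex.I * (Real.sqrt d : ℂ))) = 1) (hdim : 3 ≤ A.dim)
    (hF' : IsField A'.endAlgebra) (hnR' : ¬ IsTotallyReal (EndField A' hF')) (φ' : A' ⟶ A') {d' : ℕ} (hd' : 0 < d') (hφ' : φ' ≫ φ' = -(d' • 𝟙 A'))
    (hA'E : Module.finrank ℚ A'.endAlgebra = 2)
    (h1' : eigenMultiplicity A' φ' (Complex.I * (Real.sqrt d' : ℂ)) = 1 ∨ eigenMultiplicity A' φ' (-(Complex.I * (Real.sqrt d' : ℂ))) = 1)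
    (hdim' : 3 ≤ A'.dim) (hni : ¬ IsIsogenous A A') (hXP : IsIsogenous X ((A.prod A').prod Y)) :
    haveI := BettiUniverse.finite hX 1
    haveI := BettiUniverse.finite hP 1
    (BettiUniverse.hodge exists_isReal_hodgeModel_holds hP 1).mtRank ≤ (BettiUniverse.hodge exists_isReal_hodgeModel_holds hX 1).mtRank :=
  mtRank_hodge_one_le_of_isIsogenous_prod_of_rigid hX hP (by rw [dim_prod]; omega)
    (hodgeLie_rigid_prod_ribetTypeOne hP hF hnR φ hd hφ hAE h1 hdim hF' hnR' φ' hd' hφ' hA'E h1' hdim' hni) hXP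

end Summit.HodgeConjecture.CorCM

end
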